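import Literature.Analysis.FluidPDE.ZerothLawProofs
import Literature.Analysis.FluidPDE.TorusClassicalLerayHopfProofs
import Literature.Analysis.FluidPDE.LongTimeAverageNonneg
import Literature.Analysis.FluidPDE.LongTimeAverageSubadditive
import Literature.Analysis.FluidPDE.TimeAverageMeasureBasic
import Literature.Analysis.FunctionSpaces.TorusPlanarLift

/-!
# Stub `stub_loudOfContrast` of the line `SketchIdeator2` (card `separatrix-flux-pinning`)
# (crux `MarginalStabilityChain.ChainRealisation`, stmt-AnomalousDissipation-14249)

Sorry-free discharge of the registered stub `stub_loudOfContrast` of the lead's skeleton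
(`Cruxes/ChainRealisation/Lines/SketchIdeator2.lean`): the **budget step** turning the contrast family
(forward classical Navier–Stokes trajectories on `[0, ∞) × T³` for the `2½`-dimensional arena force
`f = twoHalf g (μ • h)`, regular, pointwise energy-bounded forward, with non-negative mean planar work
`0 ≤ liminf_T T⁻¹∫₀ᵀ ∫ ⟪g ∘ π, π_E u⟫` and an axial-contrast floor `a₀ ≤ limsup_T T⁻¹∫₀ᵀ ∫ (h ∘ π) u₂`) into a
forward-regular LOUD family for ONE smooth solenoidal mean-free force: `meanDissipation (ν j) (u j) ≥ μ a₀ > 0`.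

**Proof.**
* `f = twoHalf g (μ • h)` is smooth, divergence free and mean free (`Torus.IsSmooth.twoHalf`,
  `Torus.IsDivFree.twoHalf`, and `∫ twoHalf g (μh) = planarEmbed (∫ g, μ ∫ h) = 0` by
  `Torus.integral_comp_planarProj`).
* ENERGY EQUALITY (`Torus.IsClassicalNSSolutionOn.energy_eq`, Robinson–Rodrigo–Sadowski 2016, Thm. 6.5;
  Doering–Foias 2002, §2 (2.4)): `½‖u(T)‖² + ν∫₀ᵀ‖∇u‖² = ½‖u(0)‖² + ∫₀ᵀ∫⟪f, u⟫`, so the running means of the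
  dissipation are those of the injected power `I(t) = ∫⟪f, u(t)⟫` plus the boundary term
  `(E(0) - E(T))/T → 0` (forward energy bound); on smooth slices the spectral dissipation of
  `meanDissipation` is the classical one (`Torus.gradNormSq_eq_toReal_eGradNormSq_holds`), and the running
  means of `I` are bounded (`|I| ≤ (‖f‖₂² + C)/2`), whence
  `meanDissipation ν u = limsup_T T⁻¹∫₀ᵀ I` (`meanDissipation_eq_longTimeAvgSup_inner`).
* SPLIT of the injection (`Torus.inner_twoHalf_left`): `I = I_g + μ I_h` with the two functionals of the
  hypotheses, both with bounded running means, and `limsup (μ b + a) ≥ μ limsup b + liminf a ≥ μ a₀ + 0`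
  (Mathlib's `le_limsup_add`).

References: C. R. Doering, C. Foias, *Energy dissipation in body-forced turbulence*, J. Fluid Mech. 467 (2002)
§2; J. C. Robinson, J. L. Rodrigo, W. Sadowski, *The Three-Dimensional Navier–Stokes Equations* (CUP 2016)
Thm. 6.5.
-/

set_option linter.dupNamespace false

noncomputable section

open MeasureTheory Set Filter Topology
open scoped InnerProductSpace
open Literature.Analysis.FunctionSpaces Literature.Analysis.FunctionSpaces.Torus
open Literature.Analysis.FluidPDE

namespace Summit.AnomalousDissipation.AnomalousDissipation.Theorems.ChainRealisation.SeparatrixFluxPinning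

/-- Local notation (as in the lead's skeleton): the torus `T³`. -/
local notation "𝕋³" => UnitAddTorus (Fin 3)
/-- Local notation (as in the lead's skeleton): velocity values. -/
local notation "E³" => EuclideanSpace ℝ (Fin 3)
/-- Local notation (as in the lead's skeleton): the planar torus `T²`. -/
local notation "𝕋²" => UnitAddTorus (Fin 2)
/-- Local notation (as in the lead's skeleton): planar velocity values. -/
local notation "E²" => EuclideanSpace ℝ (Fin 2)

/-! ## Elementary inequalities and `limsup` algebra -/

/-- An integral whose integrand is dominated by `(a² + b²)/2` with `a², b²` integrable is bounded by
`(∫ a² + ∫ b²)/2` in absolute value (no integrability of the integrand is needed: a non-integrable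
integrand has integral `0`). -/
theorem abs_integral_le_of_abs_le_half_sq {α : Type*} [MeasurableSpace α] {m : Measure α}
    {F a b : α → ℝ} (hF : ∀ x, |F x| ≤ (a x ^ 2 + b x ^ 2) / 2)
    (ha : Integrable (fun x => a x ^ 2) m) (hb : Integrable (fun x => b x ^ 2) m) :
    |∫ x, F x ∂m| ≤ ((∫ x, a x ^ 2 ∂m) + ∫ x, b x ^ 2 ∂m) / 2 := by
  rw [← Real.norm_eq_abs]
  calc ‖∫ x, F x ∂m‖ ≤ ∫ x, (a x ^ 2 + b x ^ 2) / 2 ∂m :=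
        norm_integral_le_of_norm_le ((ha.add hb).div_const 2) (ae_of_all _ fun x => by
          rw [Real.norm_eq_abs]; exact hF x)
    _ = ((∫ x, a x ^ 2 ∂m) + ∫ x, b x ^ 2 ∂m) / 2 := by
        rw [integral_div, integral_add ha hb]

/-- A real `limsup` along `atTop` is unchanged by an additive perturbation tending to `0`, for an
eventually bounded main term (Mathlib's `limsup_add_le` / `le_limsup_add`). -/
theorem limsup_add_eq_of_tendsto_zero {a r : ℝ → ℝ}
    (ha : IsBoundedUnder (· ≤ ·) atTop a) (ha' : IsBoundedUnder (· ≥ ·) atTop a)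
    (hr : Tendsto r atTop (𝓝 0)) :
    limsup (fun T => a T + r T) atTop = limsup a atTop := by
  apply le_antisymm
  · calc limsup (fun T => a T + r T) atTop ≤ limsup a atTop + limsup r atTop :=
          limsup_add_le ha' ha hr.isBoundedUnder_ge.isCoboundedUnder_le hr.isBoundedUnder_le
      _ = limsup a atTop := by rw [hr.limsup_eq, add_zero]
  · calc limsup a atTop = limsup a atTop + liminf r atTop := by rw [hr.liminf_eq, add_zero]
      _ ≤ limsup (fun T => a T + r T) atTop :=
          le_limsup_add ha ha'.isCoboundedUnder_le hr.isBoundedUnder_le hr.isBoundedUnder_ge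

/-! ## The dissipation budget of a forward classical solution with bounded energy -/

section Budget

variable {d : Type*} [Fintype d] [DecidableEq d]

/-- **Mean dissipation = mean injected power** for a classical solution of the forced Navier–Stokes system
on `[0, ∞) × T^d` with a steady smooth force and a forward pointwise energy bound `∫‖u(t)‖² ≤ C` (`t ≥ 0`):
`⟨ν‖∇u‖₂²⟩ = limsup_T T⁻¹∫₀ᵀ ∫⟪f, u(t)⟫ dt`.  Energy equality on `[0, T]`
(`Torus.IsClassicalNSSolutionOn.energy_eq`, Robinson–Rodrigo–Sadowski 2016 Thm. 6.5; Doering–Foias 2002 §2)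
makes the running means of `ν‖∇u‖₂²` equal to those of the power plus `(E(0) - E(T))/T → 0`; the spectral
dissipation of `meanDissipation` agrees with the classical one on the smooth slices `t ≥ 0`
(`Torus.gradNormSq_eq_toReal_eGradNormSq_holds`), the running means only see `t > 0`, and the running means
of the power are bounded (`|∫⟪f, u(t)⟫| ≤ (‖f‖₂² + C)/2`), so the `limsup` ignores the vanishing boundary term.
The sign of `ν` plays no role. -/
theorem meanDissipation_eq_longTimeAvgSup_inner {ν : ℝ} {f : UnitAddTorus d → EuclideanSpace ℝ d}
    {u : ℝ → UnitAddTorus d → EuclideanSpace ℝ d} {p : ℝ → UnitAddTorus d → ℝ}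
    (h : IsClassicalNSSolutionOn (Ici 0) ν (fun _ => f) u p) (hf : IsSmooth f)
    {C : ℝ} (hC : ∀ t : ℝ, 0 ≤ t → ∫ x, ‖u t x‖ ^ 2 ≤ C) :
    meanDissipation ν u = longTimeAvgSup (fun t => ∫ x, ⟪f x, u t x⟫_ℝ) := by
  have hu := h.smooth_velocity
  set I : ℝ → ℝ := fun t => ∫ x, ⟪f x, u t x⟫_ℝ with hI
  set r : ℝ → ℝ := fun T => T⁻¹ * (kineticEnergy (u 0) - kineticEnergy (u T)) with hr
  -- Step 1: running means of the (spectral) dissipation = running means of the power + boundary term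
  have hmean : ∀ T, 0 < T →
      timeMean (fun t => ν * (eGradNormSq (u t)).toReal) T = timeMean I T + r T := by
    intro T hT
    have h1 : timeMean (fun t => ν * (eGradNormSq (u t)).toReal) T =
        timeMean (fun t => ν * gradNormSq (u t)) T :=
      timeMean_congr (fun t ht => by
        rw [gradNormSq_eq_toReal_eGradNormSq_holds (hu.isSmooth_slice (mem_Ici.2 ht.le))]) hT.le
    have hE := h.energy_eq (convex_Ici 0) hT.le Icc_subset_Ici_self
    have h2 : ν * ∫ τ in (0 : ℝ)..T, gradNormSq (u τ) =
        (∫ τ in (0 : ℝ)..T, I τ) + (kineticEnergy (u 0) - kineticEnergy (u T)) := by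
      simp only [hI]
      linarith
    rw [h1]
    unfold timeMean
    rw [intervalIntegral.integral_const_mul, h2, hr, mul_add]
  -- Step 2: the running means of the power are bounded
  have hIbd : ∀ t, 0 < t → |I t| ≤ ((∫ x, ‖f x‖ ^ 2) + C) / 2 := by
    intro t ht
    have hut : IsSmooth (u t) := hu.isSmooth_slice (mem_Ici.2 ht.le)
    have hpt : ∀ x, |⟪f x, u t x⟫_ℝ| ≤ (‖f x‖ ^ 2 + ‖u t x‖ ^ 2) / 2 := fun x => by
      have h1 := abs_real_inner_le_norm (f x) (u t x)
      nlinarith [sq_nonneg (‖f x‖ - ‖u t x‖), norm_nonneg (f x), norm_nonneg (u t x)]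
    calc |I t| ≤ ((∫ x, ‖f x‖ ^ 2) + ∫ x, ‖u t x‖ ^ 2) / 2 :=
          abs_integral_le_of_abs_le_half_sq hpt hf.norm_sq.integrable hut.norm_sq.integrable
      _ ≤ ((∫ x, ‖f x‖ ^ 2) + C) / 2 := by gcongr; exact hC t ht.le
  have hIb : IsBoundedUnder (· ≤ ·) atTop (timeMean I) := isBoundedUnder_le_timeMean hIbd
  have hIb' : IsBoundedUnder (· ≥ ·) atTop (timeMean I) := isBoundedUnder_ge_timeMean hIbd
  -- Step 3: the boundary term tends to zero
  have hr0 : Tendsto r atTop (𝓝 0) := by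
    have hK : ∀ T, 0 ≤ T →
        |kineticEnergy (u 0) - kineticEnergy (u T)| ≤ kineticEnergy (u 0) + C / 2 := by
      intro T hT
      have h0 := kineticEnergy_nonneg (u 0)
      have h1 := kineticEnergy_nonneg (u T)
      have h2 : kineticEnergy (u T) ≤ C / 2 := by
        have h3 := hC T hT
        unfold kineticEnergy
        linarith
      rw [abs_le]
      constructor <;> linarith
    have hlim : Tendsto (fun T : ℝ => T⁻¹ * (kineticEnergy (u 0) + C / 2)) atTop (𝓝 0) := by
      simpa using tendsto_inv_atTop_zero.mul_const (kineticEnergy (u 0) + C / 2)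
    refine squeeze_zero_norm' ?_ hlim
    filter_upwards [eventually_gt_atTop (0 : ℝ)] with T hT
    rw [Real.norm_eq_abs, hr, abs_mul, abs_of_pos (inv_pos.2 hT)]
    exact mul_le_mul_of_nonneg_left (hK T hT.le) (inv_nonneg.2 hT.le)
  -- conclusion
  have hev : timeMean (fun t => ν * (eGradNormSq (u t)).toReal) =ᶠ[atTop] fun T => timeMean I T + r T :=
    (eventually_gt_atTop (0 : ℝ)).mono fun T hT => hmean T hT
  unfold meanDissipation longTimeAvgSup
  rw [limsup_congr hev]
  exact limsup_add_eq_of_tendsto_zero hIb hIb' hr0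

end Budget

/-! ## The `2½`-dimensional arena force and the split of the injected power -/

/-- The `2½`-dimensional force `twoHalf g (μ • h)` is mean free when `g` and `h` are:
`∫ twoHalf g (μh) = planarEmbed (∫ g, μ ∫ h) = 0` (`Torus.integral_comp_planarProj`,
`ContinuousLinearMap.integral_comp_comm`). -/
theorem hasZeroMean_twoHalf_smul {g : UnitAddTorus (Fin 2) → EuclideanSpace ℝ (Fin 2)}
    {h : UnitAddTorus (Fin 2) → ℝ} (hg : IsSmooth g) (hh : IsSmooth h)
    (hg0 : HasZeroMean g) (hh0 : HasZeroMean h) (μ : ℝ) : HasZeroMean (twoHalf g (μ • h)) := by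
  -- adapted from the lead's skeleton `arena_hasZeroMean` (Cruxes/ChainRealisation/Lines/SketchIdeator2.lean)
  have hμh : IsSmooth (μ • h) := hh.smul μ
  have hpairC : Continuous (fun y : UnitAddTorus (Fin 2) => planarEmbed (g y, (μ • h) y)) :=
    planarEmbed.continuous.comp (hg.continuous.prodMk hμh.continuous)
  have hb : AEStronglyMeasurable (fun y : UnitAddTorus (Fin 2) => planarEmbed (g y, (μ • h) y)) volume :=
    hpairC.aestronglyMeasurable
  have hint : Integrable (fun y : UnitAddTorus (Fin 2) => (g y, (μ • h) y)) volume :=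
    hg.integrable.prodMk hμh.integrable
  unfold HasZeroMean
  calc ∫ x, twoHalf g (μ • h) x
      = ∫ x : UnitAddTorus (Fin 3),
          (fun y : UnitAddTorus (Fin 2) => planarEmbed (g y, (μ • h) y)) (planarProj x) := rfl
    _ = ∫ y : UnitAddTorus (Fin 2), planarEmbed (g y, (μ • h) y) := integral_comp_planarProj hb
    _ = planarEmbed (∫ y : UnitAddTorus (Fin 2), (g y, (μ • h) y)) := (planarEmbed.integral_comp_comm hint)
    _ = planarEmbed ((∫ y, g y), ∫ y, (μ • h) y) := by
        rw [integral_pair hg.integrable hμh.integrable]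
    _ = 0 := by
        have hg0' : ∫ y, g y = 0 := hg0
        have hh0' : ∫ y, (μ • h) y = 0 := by
          have : ∫ y, h y = 0 := hh0
          simp [Pi.smul_apply, smul_eq_mul, integral_const_mul, this]
        rw [hg0', hh0']
        exact map_zero planarEmbed

/-- **The contrast floor is a power floor.**  For `u` jointly smooth on `[0, ∞) × T³` with the forward
energy bound `∫‖u(t)‖² ≤ C` (`t ≥ 0`), smooth planar data `g`, `h` and `μ ≥ 0`: if the planar force does
non-negative mean work (`0 ≤ liminf_T T⁻¹∫₀ᵀ ∫⟪g ∘ π, π_E u⟫`) and the axial contrast has the floor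
`a₀ ≤ limsup_T T⁻¹∫₀ᵀ ∫ (h ∘ π) u₂`, then the injected power of the arena force `twoHalf g (μ • h)` has
`limsup`-mean `≥ μ a₀`.  Pointwise `⟪twoHalf g (μh), u⟫ = ⟪g ∘ π, π_E u⟫ + μ (h ∘ π) u₂`
(`Torus.inner_twoHalf_left`); both functionals have bounded running means (`|·| ≤ (‖·‖₂² + C)/2`), and
`limsup (μ b + a) ≥ μ limsup b + liminf a` (Mathlib's `le_limsup_add`). -/
theorem mul_le_longTimeAvgSup_inner_twoHalf {g : UnitAddTorus (Fin 2) → EuclideanSpace ℝ (Fin 2)}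
    {h : UnitAddTorus (Fin 2) → ℝ} {μ a₀ : ℝ} (hg : IsSmooth g) (hh : IsSmooth h) (hμ : 0 ≤ μ)
    {u : ℝ → UnitAddTorus (Fin 3) → EuclideanSpace ℝ (Fin 3)}
    (hu : IsSmoothSpaceTimeOn (Ici 0) u) {C : ℝ} (hC : ∀ t : ℝ, 0 ≤ t → ∫ x, ‖u t x‖ ^ 2 ≤ C)
    (hIg : 0 ≤ longTimeAvgInf (fun t => ∫ x, ⟪g (planarProj x), planarProjE (u t x)⟫_ℝ))
    (hIh : a₀ ≤ longTimeAvgSup (fun t => ∫ x, h (planarProj x) * u t x 2)) :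
    μ * a₀ ≤ longTimeAvgSup (fun t => ∫ x, ⟪twoHalf g (μ • h) x, u t x⟫_ℝ) := by
  set Ig : ℝ → ℝ := fun t => ∫ x, ⟪g (planarProj x), planarProjE (u t x)⟫_ℝ with hIg_def
  set Ih : ℝ → ℝ := fun t => ∫ x, h (planarProj x) * u t x 2 with hIh_def
  -- pointwise split of the injected power, `t ≥ 0`
  have hsplit : ∀ t : ℝ, 0 ≤ t → ∫ x, ⟪twoHalf g (μ • h) x, u t x⟫_ℝ = μ * Ih t + Ig t := by
    intro t ht
    have hut : IsSmooth (u t) := hu.isSmooth_slice (mem_Ici.2 ht)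
    have i1 : Integrable (fun x => ⟪g (planarProj x), planarProjE (u t x)⟫_ℝ) volume :=
      ((hg.continuous.comp continuous_planarProj).inner
        (planarProjE.continuous.comp hut.continuous)).integrable_unitAddTorus
    have hc2 : Continuous (fun x => u t x 2) := by
      have := hut.continuous
      fun_prop
    have i2 : Integrable (fun x => μ * (h (planarProj x) * u t x 2)) volume :=
      (((hh.continuous.comp continuous_planarProj).mul hc2).const_mul μ).integrable_unitAddTorus
    have hpt : ∀ x, ⟪twoHalf g (μ • h) x, u t x⟫_ℝ =
        ⟪g (planarProj x), planarProjE (u t x)⟫_ℝ + μ * (h (planarProj x) * u t x 2) := by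
      intro x
      rw [inner_twoHalf_left, Pi.smul_apply, smul_eq_mul, mul_assoc]
    simp_rw [hpt]
    rw [integral_add i1 i2, integral_const_mul, add_comm]
  -- continuity in time of both functionals on `[0, ∞)`, hence local integrability
  have hIgc : ContinuousOn Ig (Ici 0) :=
    ((isSmoothSpaceTimeOn_const hg.comp_planarProj (Ici 0)).inner
      (hu.clm_comp planarProjE)).continuousOn_integral (convex_Ici 0)
  have hIhc : ContinuousOn Ih (Ici 0) :=
    ((isSmoothSpaceTimeOn_const hh.comp_planarProj (Ici 0)).mul (hu.apply 2)).continuousOn_integral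
      (convex_Ici 0)
  have hint : ∀ {G : ℝ → ℝ}, ContinuousOn G (Ici 0) → ∀ T, IntegrableOn G (Ioc 0 T) volume :=
    fun hG T => ((hG.mono Icc_subset_Ici_self).integrableOn_compact isCompact_Icc).mono_set
      Ioc_subset_Icc_self
  -- pointwise bounds, `t ≥ 0`
  have hIgbd : ∀ t, 0 < t → |Ig t| ≤ ((∫ x : UnitAddTorus (Fin 3), ‖g (planarProj x)‖ ^ 2) + C) / 2 := by
    intro t ht
    have hut : IsSmooth (u t) := hu.isSmooth_slice (mem_Ici.2 ht.le)
    calc |Ig t| ≤ ((∫ x : UnitAddTorus (Fin 3), ‖g (planarProj x)‖ ^ 2) + ∫ x, ‖u t x‖ ^ 2) / 2 := by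
          refine abs_integral_le_of_abs_le_half_sq (fun x => ?_)
            ((hg.continuous.comp continuous_planarProj).norm.pow 2).integrable_unitAddTorus
            hut.norm_sq.integrable
          calc |⟪g (planarProj x), planarProjE (u t x)⟫_ℝ|
              ≤ ‖g (planarProj x)‖ * ‖planarProjE (u t x)‖ := abs_real_inner_le_norm _ _
            _ ≤ ‖g (planarProj x)‖ * ‖u t x‖ :=
                mul_le_mul_of_nonneg_left (norm_planarProjE_le _) (norm_nonneg _)
            _ ≤ (‖g (planarProj x)‖ ^ 2 + ‖u t x‖ ^ 2) / 2 := by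
                nlinarith [sq_nonneg (‖g (planarProj x)‖ - ‖u t x‖)]
      _ ≤ ((∫ x : UnitAddTorus (Fin 3), ‖g (planarProj x)‖ ^ 2) + C) / 2 := by gcongr; exact hC t ht.le
  have hIhbd : ∀ t, 0 < t →
      |μ * Ih t| ≤ μ * (((∫ x : UnitAddTorus (Fin 3), h (planarProj x) ^ 2) + C) / 2) := by
    intro t ht
    have hut : IsSmooth (u t) := hu.isSmooth_slice (mem_Ici.2 ht.le)
    rw [abs_mul, abs_of_nonneg hμ]
    refine mul_le_mul_of_nonneg_left ?_ hμ
    calc |Ih t| ≤ ((∫ x : UnitAddTorus (Fin 3), h (planarProj x) ^ 2) + ∫ x, ‖u t x‖ ^ 2) / 2 := by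
          refine abs_integral_le_of_abs_le_half_sq (fun x => ?_)
            ((hh.continuous.comp continuous_planarProj).pow 2).integrable_unitAddTorus
            hut.norm_sq.integrable
          have h2 : |u t x 2| ≤ ‖u t x‖ := by simpa using PiLp.norm_apply_le (u t x) 2
          calc |h (planarProj x) * u t x 2| = |h (planarProj x)| * |u t x 2| := abs_mul _ _
            _ ≤ |h (planarProj x)| * ‖u t x‖ := mul_le_mul_of_nonneg_left h2 (abs_nonneg _)
            _ ≤ (h (planarProj x) ^ 2 + ‖u t x‖ ^ 2) / 2 := by
                nlinarith [sq_nonneg (|h (planarProj x)| - ‖u t x‖), sq_abs (h (planarProj x))]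
      _ ≤ ((∫ x : UnitAddTorus (Fin 3), h (planarProj x) ^ 2) + C) / 2 := by gcongr; exact hC t ht.le
  -- boundedness of the running means
  have h₁ : IsBoundedUnder (· ≤ ·) atTop (timeMean fun t => μ * Ih t) := isBoundedUnder_le_timeMean hIhbd
  have h₂ : IsCoboundedUnder (· ≤ ·) atTop (timeMean fun t => μ * Ih t) :=
    (isBoundedUnder_ge_timeMean hIhbd).isCoboundedUnder_le
  have h₃ : IsBoundedUnder (· ≤ ·) atTop (timeMean Ig) := isBoundedUnder_le_timeMean hIgbd
  have h₄ : IsBoundedUnder (· ≥ ·) atTop (timeMean Ig) := isBoundedUnder_ge_timeMean hIgbd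
  -- the running means split accordingly
  have hev : timeMean (fun t => ∫ x, ⟪twoHalf g (μ • h) x, u t x⟫_ℝ) =ᶠ[atTop]
      ((timeMean fun t => μ * Ih t) + timeMean Ig) := by
    filter_upwards [eventually_ge_atTop (0 : ℝ)] with T hT
    rw [Pi.add_apply, timeMean_congr (fun t ht => hsplit t ht.le) hT,
      timeMean_add hT ((hint hIhc T).const_mul μ) (hint hIgc T)]
  unfold longTimeAvgSup
  rw [limsup_congr hev]
  have hsup : limsup (timeMean fun t => μ * Ih t) atTop = μ * longTimeAvgSup Ih :=
    longTimeAvgSup_const_mul hμ Ih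
  calc μ * a₀ ≤ μ * longTimeAvgSup Ih + longTimeAvgInf Ig := by
        have h1 : μ * a₀ ≤ μ * longTimeAvgSup Ih := mul_le_mul_of_nonneg_left hIh hμ
        linarith
    _ = limsup (timeMean fun t => μ * Ih t) atTop + liminf (timeMean Ig) atTop := by
        rw [hsup]; rfl
    _ ≤ limsup ((timeMean fun t => μ * Ih t) + timeMean Ig) atTop := le_limsup_add h₁ h₂ h₃ h₄

/-! ## The stub -/

/-- **Stub `stub_loudOfContrast` (the budget step of the line `SketchIdeator2`).**  A contrast family — smooth
planar solenoidal mean-free `g`, smooth mean-free axial pattern `h`, amplitude `μ > 0`, contrast floor `a₀ > 0`,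
energy ceiling `E`, and along `ν_j → 0` forward classical trajectories on `[0, ∞) × T³` for the arena force
`twoHalf g (μ • h)` that are regular, pointwise energy-bounded forward, of mean energy `≤ E`, with
non-negative mean planar work and axial contrast `≥ a₀` — yields a forward-regular LOUD bounded family for the
ONE force `f = twoHalf g (μ • h)` (smooth, solenoidal, mean free): by energy equality the mean dissipation is
the mean injected power (`meanDissipation_eq_longTimeAvgSup_inner`), which splits as
`⟨⟪g ∘ π, π_E u⟫⟩ + μ⟨(h ∘ π) u₂⟩ ≥ 0 + μ a₀` (`mul_le_longTimeAvgSup_inner_twoHalf`), so `ε = μ a₀ > 0`. -/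
theorem stub_loudOfContrast :
    (∃ (g : 𝕋² → E²) (h : 𝕋² → ℝ) (μ a₀ E : ℝ),
      IsSmooth g ∧ IsDivFree g ∧ HasZeroMean g ∧ IsSmooth h ∧ HasZeroMean h ∧ 0 < μ ∧ 0 < a₀ ∧
      ∃ (ν : ℕ → ℝ) (u : ℕ → ℝ → 𝕋³ → E³) (p : ℕ → ℝ → 𝕋³ → ℝ),
        (∀ j, 0 < ν j) ∧ Tendsto ν atTop (nhds 0) ∧
        (∀ j, IsClassicalNSSolutionOn (Set.Ici 0) (ν j) (fun _ => twoHalf g (μ • h)) (u j) (p j)) ∧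
        (∀ j, ∃ M : ℝ, ∀ t : ℝ, 1 ≤ t → gradNormSq (u j t) ≤ M) ∧
        (∀ j, ∃ C : ℝ, ∀ t : ℝ, 0 ≤ t → ∫ x, ‖u j t x‖ ^ 2 ≤ C) ∧
        (∀ j, meanEnergy (u j) ≤ E) ∧
        (∀ j, 0 ≤ longTimeAvgInf (fun t => ∫ x, ⟪g (planarProj x), planarProjE (u j t x)⟫_ℝ)) ∧
        (∀ j, a₀ ≤ longTimeAvgSup (fun t => ∫ x, h (planarProj x) * u j t x 2))) →
    ∃ f : 𝕋³ → E³, IsSmooth f ∧ IsDivFree f ∧ HasZeroMean f ∧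
      ∃ (ν : ℕ → ℝ) (u : ℕ → ℝ → 𝕋³ → E³) (p : ℕ → ℝ → 𝕋³ → ℝ),
        (∀ j, 0 < ν j) ∧ Tendsto ν atTop (nhds 0) ∧
        (∀ j, IsClassicalNSSolutionOn (Set.Ici 0) (ν j) (fun _ => f) (u j) (p j)) ∧
        (∀ j, ∃ M : ℝ, ∀ t : ℝ, 1 ≤ t → gradNormSq (u j t) ≤ M) ∧
        (∃ E : ℝ, ∀ j, meanEnergy (u j) ≤ E) ∧
        ∃ ε : ℝ, 0 < ε ∧ ∀ j, ε ≤ meanDissipation (ν j) (u j) := by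
  rintro ⟨g, h, μ, a₀, E, hg, hdiv, hg0, hh, hh0, hμ, ha₀, ν, u, p, hν, hν0, hsol, hM, hC, hE, hIg, hIh⟩
  have hf : IsSmooth (twoHalf g (μ • h)) := hg.twoHalf (hh.smul μ)
  refine ⟨twoHalf g (μ • h), hf, hdiv.twoHalf _, hasZeroMean_twoHalf_smul hg hh hg0 hh0 μ, ν, u, p, hν,
    hν0, hsol, hM, ⟨E, hE⟩, μ * a₀, mul_pos hμ ha₀, fun j => ?_⟩
  obtain ⟨C, hCj⟩ := hC j
  rw [meanDissipation_eq_longTimeAvgSup_inner (hsol j) hf hCj]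
  exact mul_le_longTimeAvgSup_inner_twoHalf hg hh hμ.le (hsol j).smooth_velocity hCj (hIg j) (hIh j)

end Summit.AnomalousDissipation.AnomalousDissipation.Theorems.ChainRealisation.SeparatrixFluxPinning

end
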